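import Summits.CriticalPhenomena.PercolationContinuityZ3.Theorems.PercNearOneGluingAdditiveGluingKnThm2Good
import Summits.CriticalPhenomena.PercolationContinuityZ3.Theorems.PercNearOneGluingAdditiveGluingBhkSets
import HarnessLib

/-! # Crux `PercNearOneGluing.AdditiveGluing` (stmt-CriticalPhenomena-4576) — a REFINED Kozma–Nitzan Theorem 2 exchange,
# auxiliary file: set-BHK for events about a SUB-set of the source set, bookkeeping identities, arithmetic core
# (seat (d) exchange-certificate form, gen 2)

Support file (`--supports stmt-CriticalPhenomena-4576`); no definitions, no named facts, no sorries.  The assembly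
(`knThm2_refined`, `knThm2_refined'`, `knThm2_refined_eform`) is the sibling file `…KnThm2Refined.lean`.

Kozma–Nitzan (arXiv:2401.12397, Theorem 2, pp. 8–9) write `X := μ(o↔A, o↔b) − μ(o↔A, a₃↔b) = I + II + III` and bound each of
`I, II, III` by two van den Berg–Häggström–Kahn steps with the source sets `O = {a₁,a₂}, {a₁}, {a₂}` conditioned on
`N_O = {O ↮ A ∖ O}`.  On every event occurring in `I, II, III` the observer `o` is joined to `O`, hence NOT joined to `A ∖ O`;
so the same six steps can be run with the source set `O ∪ {o}` and the conditioning event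
`N'_O = {O ∪ {o} ↮ A ∖ O} = N_O ∩ {o ↮ A ∖ O}` (BHK 2006 Thm. 1.3 for the cluster of the SET `O ∪ {o}`, Thm. 1.4 for the clusters
of `O ∪ {o}` and `A ∖ O`).  This gives (`knThm2_refined`)
  `P'₁ P'₂ P'₁₂ · X ≥ P'₁ P'₂ · A₁₂ (m'₁₂ − m'₃) + P'₂ P'₁₂ · A₁ (m'₁ − m'₂₃) + P'₁ P'₁₂ · A₂ (m''₂ − m''₁₃)`,
`P'_O = μ(N'_O)`, `A_O = μ(N'_O ∩ {O ↔ o}) (= μ(N_O ∩ {O ↔ o}))`, `m'_T = μ(N'_O ∩ {b ↔ all of T})` — i.e. in conditional form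
`X ≥ Σ_O φ'_O (m'_O − m'_{A∖O})` with the REFINED attachments `φ'_O = μ(o ↔ O | O ∪ {o} ↮ A ∖ O) = φ_O / (1 − φ_{A∖O}) ≥ φ_O`.
Each refined step is at least as strong as KN's (one more BHK correlation: `{b ↔ all of O}` resp. `{b ↔ all of A∖O}` is
positively resp. negatively correlated with `{o ↮ A∖O}` given `N_O`), no Lemma 2 and no minimality is used, and the certificate
closes configurations where KN's bound `Σ_O φ_O (m_O − m_{A∖O})` is negative (hub configurations: `o` joined to the relays through a
common hub; exact engine of this seat, lab/refined.py: e.g. `X = .0059`, KN bound `−.0022`, refined bound `+.0042`).  The rational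
weights `φ₂/(1−φ₁₃)` of the three-relay certificate charts (`chartF2_slack`) are exactly refined attachments.
Corollaries: the additive E-form (`knThm2_refined_eform`) and the designated-pocket-kernel block form (`dKernel_three_of_knThm2Refined`).
[cite: KozmaNitzan2024, Theorem 2 (§3.2, pp. 8–9); VandenbergHaggstromKahn2005, Thms. 1.3–1.4 (pp. 6–7)]
-/

namespace Summit.CriticalPhenomena.PercolationContinuityZ3.Theorems

open MeasureTheory Set Literature.Probability.LatticeModels Literature.Probability.Percolation

noncomputable section
open Classical

section General

variable {V : Type*}

/-- At `C = C_S(ω)` and for `O ⊆ S`: the indicator of `{C | ∃ s ∈ O, s ↔ x in C}` is `1{O ↔ x}(ω)`. [folklore] -/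
theorem knRef_anyReach_apply_sub (S O : Finset V) (hOS : O ⊆ S) (x : V) (ω : BondConfig V) :
    {C : Set (Sym2 V) | ∃ s ∈ O, (openGraph C).Reachable s x}.indicator (1 : Set (Sym2 V) → ℝ)
        (⋃ s' ∈ S, openEdgeCluster ω s') =
      (⋃ s ∈ O, (openConn s x : Set (BondConfig V))).indicator 1 ω := by
  by_cases h : ∃ s ∈ O, (openGraph ω).Reachable s x
  · have h1 : (⋃ s' ∈ S, openEdgeCluster ω s') ∈
        {C : Set (Sym2 V) | ∃ s ∈ O, (openGraph C).Reachable s x} := by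
      obtain ⟨s, hs, hr⟩ := h
      exact ⟨s, hs, (knThm2_reachable_biUnion_iff S (hOS hs) x ω).2 hr⟩
    have h2 : ω ∈ ⋃ s ∈ O, (openConn s x : Set (BondConfig V)) := by
      simp only [Set.mem_iUnion, exists_prop]
      exact h
    rw [Set.indicator_of_mem h1, Set.indicator_of_mem h2, Pi.one_apply, Pi.one_apply]
  · have h1 : (⋃ s' ∈ S, openEdgeCluster ω s') ∉
        {C : Set (Sym2 V) | ∃ s ∈ O, (openGraph C).Reachable s x} := by
      rintro ⟨s, hs, hr⟩
      exact h ⟨s, hs, (knThm2_reachable_biUnion_iff S (hOS hs) x ω).1 hr⟩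
    have h2 : ω ∉ ⋃ s ∈ O, (openConn s x : Set (BondConfig V)) := by
      simp only [Set.mem_iUnion, exists_prop]
      exact h
    rw [Set.indicator_of_notMem h1, Set.indicator_of_notMem h2]

/-- At `C = C_S(ω)` and for `O ⊆ S`: the indicator of `{C | ∀ s ∈ O, s ↔ x in C}` is `1{∀ s ∈ O, s ↔ x}(ω)`. [folklore] -/
theorem knRef_allReach_apply_sub (S O : Finset V) (hOS : O ⊆ S) (x : V) (ω : BondConfig V) :
    {C : Set (Sym2 V) | ∀ s ∈ O, (openGraph C).Reachable s x}.indicator (1 : Set (Sym2 V) → ℝ)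
        (⋃ s' ∈ S, openEdgeCluster ω s') =
      (⋂ s ∈ O, (openConn s x : Set (BondConfig V))).indicator 1 ω := by
  by_cases h : ∀ s ∈ O, (openGraph ω).Reachable s x
  · have h1 : (⋃ s' ∈ S, openEdgeCluster ω s') ∈
        {C : Set (Sym2 V) | ∀ s ∈ O, (openGraph C).Reachable s x} :=
      fun s hs => (knThm2_reachable_biUnion_iff S (hOS hs) x ω).2 (h s hs)
    have h2 : ω ∈ ⋂ s ∈ O, (openConn s x : Set (BondConfig V)) := by
      simp only [Set.mem_iInter]
      exact h
    rw [Set.indicator_of_mem h1, Set.indicator_of_mem h2, Pi.one_apply, Pi.one_apply]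
  · have h1 : (⋃ s' ∈ S, openEdgeCluster ω s') ∉
        {C : Set (Sym2 V) | ∀ s ∈ O, (openGraph C).Reachable s x} :=
      fun h' => h fun s hs => (knThm2_reachable_biUnion_iff S (hOS hs) x ω).1 (h' s hs)
    have h2 : ω ∉ ⋂ s ∈ O, (openConn s x : Set (BondConfig V)) := by
      simp only [Set.mem_iInter]
      exact h
    rw [Set.indicator_of_notMem h1, Set.indicator_of_notMem h2]

end General

variable {n : ℕ}

/-- **BHK 2006 Thm. 1.3 for the cluster of the set `S`, events about a SUB-set `O ⊆ S`** (hypothesis `hB1` = first half of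
`stub_bhkSets`): with `D = {S ↮ X}`, `μ(D ∩ {O ↔ o}) μ(D ∩ ⋂_{O} {s ↔ b}) ≤ μ(D) μ(D ∩ {O ↔ o} ∩ ⋂_{O} {s ↔ b})`.
Used with `S = O ∪ {o}`. [cite: VandenbergHaggstromKahn2005, Thm. 1.3 (p. 6)] -/
theorem knRef_bhkOne
    (hB1 : ∀ (n : ℕ) (w : Sym2 (Fin n) → unitInterval) (S : Finset (Fin n)) (X : Set (Fin n))
        (F G : Set (Sym2 (Fin n)) → ℝ), Monotone F → Monotone G → (∀ s ∈ S, s ∉ X) →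
        (∫ ω in {ω : BondConfig (Fin n) | ∀ s ∈ S, ∀ x ∈ X, ¬ (openGraph ω).Reachable s x},
            F (⋃ s ∈ S, openEdgeCluster ω s) ∂(prodBernoulli w)) *
          (∫ ω in {ω : BondConfig (Fin n) | ∀ s ∈ S, ∀ x ∈ X, ¬ (openGraph ω).Reachable s x},
            G (⋃ s ∈ S, openEdgeCluster ω s) ∂(prodBernoulli w)) ≤
        (prodBernoulli w).real
            {ω : BondConfig (Fin n) | ∀ s ∈ S, ∀ x ∈ X, ¬ (openGraph ω).Reachable s x} *
          ∫ ω in {ω : BondConfig (Fin n) | ∀ s ∈ S, ∀ x ∈ X, ¬ (openGraph ω).Reachable s x},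
            F (⋃ s ∈ S, openEdgeCluster ω s) * G (⋃ s ∈ S, openEdgeCluster ω s)
              ∂(prodBernoulli w))
    (w : Sym2 (Fin n) → unitInterval) (S O : Finset (Fin n)) (hOS : O ⊆ S) (X : Set (Fin n)) (o b : Fin n)
    (hSX : ∀ s ∈ S, s ∉ X) :
    (prodBernoulli w).real
          ({ω : BondConfig (Fin n) | ∀ s ∈ S, ∀ x ∈ X, ¬ (openGraph ω).Reachable s x} ∩
            ⋃ s ∈ O, openConn s o) *
        (prodBernoulli w).real
          ({ω : BondConfig (Fin n) | ∀ s ∈ S, ∀ x ∈ X, ¬ (openGraph ω).Reachable s x} ∩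
            ⋂ s ∈ O, openConn s b) ≤
      (prodBernoulli w).real
          {ω : BondConfig (Fin n) | ∀ s ∈ S, ∀ x ∈ X, ¬ (openGraph ω).Reachable s x} *
        (prodBernoulli w).real
          ({ω : BondConfig (Fin n) | ∀ s ∈ S, ∀ x ∈ X, ¬ (openGraph ω).Reachable s x} ∩
            ((⋃ s ∈ O, openConn s o) ∩ ⋂ s ∈ O, openConn s b)) := by
  have key := hB1 n w S X
    ({C : Set (Sym2 (Fin n)) | ∃ s ∈ O, (openGraph C).Reachable s o}.indicator 1)
    ({C : Set (Sym2 (Fin n)) | ∀ s ∈ O, (openGraph C).Reachable s b}.indicator 1)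
    (knThm2_monotone_anyReach O o) (knThm2_monotone_allReach O b) hSX
  simp only [knRef_anyReach_apply_sub S O hOS, knRef_allReach_apply_sub S O hOS] at key
  have h := knThm2_setIntegral_indicator w
    {ω : BondConfig (Fin n) | ∀ s ∈ S, ∀ x ∈ X, ¬ (openGraph ω).Reachable s x}
    (⋃ s ∈ O, openConn s o) (⋂ s ∈ O, openConn s b)
  have h' := knThm2_setIntegral_indicator w
    {ω : BondConfig (Fin n) | ∀ s ∈ S, ∀ x ∈ X, ¬ (openGraph ω).Reachable s x}
    (⋂ s ∈ O, openConn s b) (⋂ s ∈ O, openConn s b)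
  rw [h.1, h'.1, h.2] at key
  exact key

/-- **BHK 2006 Thm. 1.4 for the clusters of disjoint sets `S, S'`, events about sub-sets `O ⊆ S`, `O' ⊆ S'`** (hypothesis
`hB2` = second half of `stub_bhkSets`): with `D = {S ↮ S'}`,
`μ(D) μ(D ∩ {O ↔ o} ∩ ⋂_{O'} {s ↔ b}) ≤ μ(D ∩ {O ↔ o}) μ(D ∩ ⋂_{O'} {s ↔ b})`.  Used with `S = O ∪ {o}`, `S' = O' = A ∖ O`.
[cite: VandenbergHaggstromKahn2005, Thm. 1.4 (p. 7)] -/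
theorem knRef_bhkTwo
    (hB2 : ∀ (n : ℕ) (w : Sym2 (Fin n) → unitInterval) (S S' : Finset (Fin n))
        (F G : Set (Sym2 (Fin n)) → ℝ), Monotone F → Monotone G → Disjoint S S' →
        (prodBernoulli w).real
            {ω : BondConfig (Fin n) | ∀ s ∈ S, ∀ x ∈ S', ¬ (openGraph ω).Reachable s x} *
          (∫ ω in {ω : BondConfig (Fin n) | ∀ s ∈ S, ∀ x ∈ S', ¬ (openGraph ω).Reachable s x},
            F (⋃ s ∈ S, openEdgeCluster ω s) * G (⋃ s ∈ S', openEdgeCluster ω s)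
              ∂(prodBernoulli w)) ≤
        (∫ ω in {ω : BondConfig (Fin n) | ∀ s ∈ S, ∀ x ∈ S', ¬ (openGraph ω).Reachable s x},
            F (⋃ s ∈ S, openEdgeCluster ω s) ∂(prodBernoulli w)) *
          (∫ ω in {ω : BondConfig (Fin n) | ∀ s ∈ S, ∀ x ∈ S', ¬ (openGraph ω).Reachable s x},
            G (⋃ s ∈ S', openEdgeCluster ω s) ∂(prodBernoulli w)))
    (w : Sym2 (Fin n) → unitInterval) (S S' O O' : Finset (Fin n)) (hOS : O ⊆ S) (hO'S' : O' ⊆ S') (o b : Fin n)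
    (hSS' : Disjoint S S') :
    (prodBernoulli w).real
          {ω : BondConfig (Fin n) | ∀ s ∈ S, ∀ x ∈ S', ¬ (openGraph ω).Reachable s x} *
        (prodBernoulli w).real
          ({ω : BondConfig (Fin n) | ∀ s ∈ S, ∀ x ∈ S', ¬ (openGraph ω).Reachable s x} ∩
            ((⋃ s ∈ O, openConn s o) ∩ ⋂ s ∈ O', openConn s b)) ≤
      (prodBernoulli w).real
          ({ω : BondConfig (Fin n) | ∀ s ∈ S, ∀ x ∈ S', ¬ (openGraph ω).Reachable s x} ∩
            ⋃ s ∈ O, openConn s o) *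
        (prodBernoulli w).real
          ({ω : BondConfig (Fin n) | ∀ s ∈ S, ∀ x ∈ S', ¬ (openGraph ω).Reachable s x} ∩
            ⋂ s ∈ O', openConn s b) := by
  have key := hB2 n w S S'
    ({C : Set (Sym2 (Fin n)) | ∃ s ∈ O, (openGraph C).Reachable s o}.indicator 1)
    ({C : Set (Sym2 (Fin n)) | ∀ s ∈ O', (openGraph C).Reachable s b}.indicator 1)
    (knThm2_monotone_anyReach O o) (knThm2_monotone_allReach O' b) hSS'
  simp only [knRef_anyReach_apply_sub S O hOS, knRef_allReach_apply_sub S' O' hO'S'] at key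
  have h := knThm2_setIntegral_indicator w
    {ω : BondConfig (Fin n) | ∀ s ∈ S, ∀ x ∈ S', ¬ (openGraph ω).Reachable s x}
    (⋃ s ∈ O, openConn s o) (⋂ s ∈ O', openConn s b)
  have h' := knThm2_setIntegral_indicator w
    {ω : BondConfig (Fin n) | ∀ s ∈ S, ∀ x ∈ S', ¬ (openGraph ω).Reachable s x}
    (⋂ s ∈ O', openConn s b) (⋂ s ∈ O', openConn s b)
  rw [h.1, h'.1, h.2] at key
  exact key


/-! ### The refined conditioning events and the bookkeeping identities -/

/-- `{S ↮ X} = N'₁₂ := {a₁↮a₃} ∩ {a₂↮a₃} ∩ {o↮a₃}` for `S = {a₁, a₂, o}`, `X = {a₃} ⊆ V`. [folklore] -/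
theorem knRef_sep3_set (a₁ a₂ o a₃ : Fin n) :
    {ω : BondConfig (Fin n) | ∀ s ∈ ({a₁, a₂, o} : Finset (Fin n)), ∀ x ∈ ({a₃} : Set (Fin n)),
        ¬ (openGraph ω).Reachable s x} = (openConn a₁ a₃)ᶜ ∩ (openConn a₂ a₃)ᶜ ∩ (openConn o a₃)ᶜ := by
  ext ω
  simp only [Finset.mem_insert, Finset.mem_singleton, Set.mem_singleton_iff, forall_eq_or_imp,
    forall_eq, Set.mem_setOf_eq, Set.mem_inter_iff, Set.mem_compl_iff, knThm2_mem_openConn, and_assoc]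

/-- `{S ↮ S'} = N'₁₂` for `S = {a₁, a₂, o}`, `S' = {a₃}` (finsets). [folklore] -/
theorem knRef_sep3_finset (a₁ a₂ o a₃ : Fin n) :
    {ω : BondConfig (Fin n) | ∀ s ∈ ({a₁, a₂, o} : Finset (Fin n)), ∀ x ∈ ({a₃} : Finset (Fin n)),
        ¬ (openGraph ω).Reachable s x} = (openConn a₁ a₃)ᶜ ∩ (openConn a₂ a₃)ᶜ ∩ (openConn o a₃)ᶜ := by
  ext ω
  simp only [Finset.mem_insert, Finset.mem_singleton, forall_eq_or_imp, forall_eq,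
    Set.mem_setOf_eq, Set.mem_inter_iff, Set.mem_compl_iff, knThm2_mem_openConn, and_assoc]

/-- `{S ↮ X} = N'₁ := {a₁↮a₂} ∩ {a₁↮a₃} ∩ ({o↮a₂} ∩ {o↮a₃})` for `S = {a₁, o}`, `X = {a₂, a₃} ⊆ V`. [folklore] -/
theorem knRef_sep2_set (a₁ o a₂ a₃ : Fin n) :
    {ω : BondConfig (Fin n) | ∀ s ∈ ({a₁, o} : Finset (Fin n)), ∀ x ∈ ({a₂, a₃} : Set (Fin n)),
        ¬ (openGraph ω).Reachable s x} =
      (openConn a₁ a₂)ᶜ ∩ (openConn a₁ a₃)ᶜ ∩ ((openConn o a₂)ᶜ ∩ (openConn o a₃)ᶜ) := by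
  ext ω
  simp only [Finset.mem_insert, Finset.mem_singleton, Set.mem_insert_iff, Set.mem_singleton_iff,
    forall_eq_or_imp, forall_eq, Set.mem_setOf_eq, Set.mem_inter_iff, Set.mem_compl_iff, knThm2_mem_openConn,
    and_assoc]

/-- `{S ↮ S'} = N'₁` for `S = {a₁, o}`, `S' = {a₂, a₃}` (finsets). [folklore] -/
theorem knRef_sep2_finset (a₁ o a₂ a₃ : Fin n) :
    {ω : BondConfig (Fin n) | ∀ s ∈ ({a₁, o} : Finset (Fin n)), ∀ x ∈ ({a₂, a₃} : Finset (Fin n)),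
        ¬ (openGraph ω).Reachable s x} =
      (openConn a₁ a₂)ᶜ ∩ (openConn a₁ a₃)ᶜ ∩ ((openConn o a₂)ᶜ ∩ (openConn o a₃)ᶜ) := by
  ext ω
  simp only [Finset.mem_insert, Finset.mem_singleton, forall_eq_or_imp, forall_eq,
    Set.mem_setOf_eq, Set.mem_inter_iff, Set.mem_compl_iff, knThm2_mem_openConn, and_assoc]

/-- On `N₁₂ ∩ {A₁₂ ↔ o}` the observer is not joined to `a₃`: `N₁₂ ∩ ({A₁₂ ↔ o} ∩ E) = N'₁₂ ∩ ({A₁₂ ↔ o} ∩ E)`. [folklore] -/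
theorem knRef_absorb12 (o a₁ a₂ a₃ : Fin n) (E : Set (BondConfig (Fin n))) :
    ((openConn a₁ a₃)ᶜ ∩ (openConn a₂ a₃)ᶜ ∩ ((openConn a₁ o ∪ openConn a₂ o) ∩ E) : Set (BondConfig (Fin n))) =
      (openConn a₁ a₃)ᶜ ∩ (openConn a₂ a₃)ᶜ ∩ (openConn o a₃)ᶜ ∩ ((openConn a₁ o ∪ openConn a₂ o) ∩ E) := by
  ext ω
  simp only [Set.mem_inter_iff, Set.mem_compl_iff, Set.mem_union, knThm2_mem_openConn]
  constructor
  · rintro ⟨⟨h13, h23⟩, hU, hE⟩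
    refine ⟨⟨⟨h13, h23⟩, fun ho => ?_⟩, hU, hE⟩
    rcases hU with h1 | h2
    · exact h13 (h1.trans ho)
    · exact h23 (h2.trans ho)
  · rintro ⟨⟨⟨h13, h23⟩, -⟩, hU, hE⟩
    exact ⟨⟨h13, h23⟩, hU, hE⟩

/-- On `N₁ ∩ {a₁ ↔ o}` the observer is not joined to `a₂, a₃`: `N₁ ∩ ({a₁ ↔ o} ∩ E) = N'₁ ∩ ({a₁ ↔ o} ∩ E)`. [folklore] -/
theorem knRef_absorb1 (o a₁ a₂ a₃ : Fin n) (E : Set (BondConfig (Fin n))) :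
    ((openConn a₁ a₂)ᶜ ∩ (openConn a₁ a₃)ᶜ ∩ (openConn a₁ o ∩ E) : Set (BondConfig (Fin n))) =
      (openConn a₁ a₂)ᶜ ∩ (openConn a₁ a₃)ᶜ ∩ ((openConn o a₂)ᶜ ∩ (openConn o a₃)ᶜ) ∩ (openConn a₁ o ∩ E) := by
  ext ω
  simp only [Set.mem_inter_iff, Set.mem_compl_iff, knThm2_mem_openConn]
  constructor
  · rintro ⟨⟨h12, h13⟩, h1o, hE⟩
    exact ⟨⟨⟨h12, h13⟩, fun ho => h12 (h1o.trans ho), fun ho => h13 (h1o.trans ho)⟩, h1o, hE⟩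
  · rintro ⟨⟨⟨h12, h13⟩, -⟩, h1o, hE⟩
    exact ⟨⟨h12, h13⟩, h1o, hE⟩

/-- **Real-arithmetic core of the refined exchange.**  From the six refined BHK bounds `A₁₂ m₁₂ ≤ P₁₂ T₁₂`, `P₁₂ U₁₂ ≤ A₁₂ m₃`,
`A₁ m₁ ≤ P₁ T₁`, `P₁ U₁ ≤ A₁ m₂₃`, `A₂ m₂ ≤ P₂ T₂`, `P₂ U₂ ≤ A₂ m₁₃` with `P₁, P₂, P₁₂ > 0` and the certificate
`P₁ P₂ · A₁₂ (m₁₂ − m₃) + P₂ P₁₂ · A₁ (m₁ − m₂₃) + P₁ P₁₂ · A₂ (m₂ − m₁₃) ≥ 0`:  `(T₁₂ − U₁₂) + (T₁ − U₁) + (T₂ − U₂) ≥ 0`. [folklore] -/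
theorem knRef_arith {T₁₂ U₁₂ T₁ U₁ T₂ U₂ P₁₂ P₁ P₂ A₁₂ A₁ A₂ m₁₂ m₃ m₁ m₂₃ m₂ m₁₃ : ℝ}
    (hP₁₂ : 0 < P₁₂) (hP₁ : 0 < P₁) (hP₂ : 0 < P₂)
    (h1 : A₁₂ * m₁₂ ≤ P₁₂ * T₁₂) (h2 : P₁₂ * U₁₂ ≤ A₁₂ * m₃)
    (h3 : A₁ * m₁ ≤ P₁ * T₁) (h4 : P₁ * U₁ ≤ A₁ * m₂₃)
    (h5 : A₂ * m₂ ≤ P₂ * T₂) (h6 : P₂ * U₂ ≤ A₂ * m₁₃)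
    (hcert : 0 ≤ P₁ * P₂ * (A₁₂ * (m₁₂ - m₃)) + P₂ * P₁₂ * (A₁ * (m₁ - m₂₃)) + P₁ * P₁₂ * (A₂ * (m₂ - m₁₃))) :
    0 ≤ (T₁₂ - U₁₂) + (T₁ - U₁) + (T₂ - U₂) := by
  have ha : A₁₂ * (m₁₂ - m₃) ≤ P₁₂ * (T₁₂ - U₁₂) := by linarith
  have hb : A₁ * (m₁ - m₂₃) ≤ P₁ * (T₁ - U₁) := by linarith
  have hc : A₂ * (m₂ - m₁₃) ≤ P₂ * (T₂ - U₂) := by linarith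
  have ha' : P₁ * P₂ * (A₁₂ * (m₁₂ - m₃)) ≤ P₁ * P₂ * (P₁₂ * (T₁₂ - U₁₂)) :=
    mul_le_mul_of_nonneg_left ha (mul_nonneg hP₁.le hP₂.le)
  have hb' : P₂ * P₁₂ * (A₁ * (m₁ - m₂₃)) ≤ P₂ * P₁₂ * (P₁ * (T₁ - U₁)) :=
    mul_le_mul_of_nonneg_left hb (mul_nonneg hP₂.le hP₁₂.le)
  have hc' : P₁ * P₁₂ * (A₂ * (m₂ - m₁₃)) ≤ P₁ * P₁₂ * (P₂ * (T₂ - U₂)) :=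
    mul_le_mul_of_nonneg_left hc (mul_nonneg hP₁.le hP₁₂.le)
  have hid : P₁ * P₂ * (P₁₂ * (T₁₂ - U₁₂)) + P₂ * P₁₂ * (P₁ * (T₁ - U₁)) + P₁ * P₁₂ * (P₂ * (T₂ - U₂)) =
      (P₁ * P₂ * P₁₂) * ((T₁₂ - U₁₂) + (T₁ - U₁) + (T₂ - U₂)) := by ring
  have hprod : 0 < P₁ * P₂ * P₁₂ := mul_pos (mul_pos hP₁ hP₂) hP₁₂
  have hge : 0 ≤ (P₁ * P₂ * P₁₂) * ((T₁₂ - U₁₂) + (T₁ - U₁) + (T₂ - U₂)) := by linarith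
  by_contra hneg
  push Not at hneg
  have := mul_neg_of_pos_of_neg hprod hneg
  linarith

end

end Summit.CriticalPhenomena.PercolationContinuityZ3.Theorems
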